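import Mathlib
import Literature.RingTheory.DedekindDomain.BlockIdempotentAtLevel          -- ★ (W-α1) `exists_blockIdempotentAtLevel` (generic Dedekind + ring involution)
import Literature.NumberTheory.NumberFields.IdealNormEquationSupportPin     -- ★ p847992 `count_eq_count_span_of_sup_complexConj_smul_eq_top`, `pow_dvd_iff_le_count`
import Literature.NumberTheory.NumberFields.FrobeniusCoidealBlockCongruence -- ★ `frobCoideal_block_rows` (the two `w`-block rows `h𝔠₁`, `h𝔠₂`)
import Literature.NumberTheory.Automorphic.AdelicUnitaryGroup               -- ★ `cmConjRingHom` (the consumer's spelling of complex conjugation)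
import HarnessLib

/-!
# The `𝔭_{c•w}`-block idempotent of `𝓞 F ∕ p^f` for a CM field, and the Frobenius co-ideal rows from the twist-norm tokens

Topic `Literature/NumberTheory/NumberFields`, namespace `Literature.NumberTheory.NumberFields`.  THEOREMS ONLY (no `def`, no instance, no named fact);
Mathlib + ★ `BlockIdempotentAtLevel` + ★ `IdealNormEquationSupportPin` + ★ `FrobeniusCoidealBlockCongruence` + ★ `AdelicUnitaryGroup` (`cmConjRingHom`).

THE MATHEMATICS ([Neukirch1999] Ch. I §3 (3.6); [Shimura1998] §13.1 Thm. 1 (pp. 97–99), the prime factorisation of the Frobenius ideal of a CM reduction: `w`-part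
`𝔭_w^{e_w f_w}`).  For a CM number field `F` with complex conjugation `c` (as the ring endomorphism `star = RingOfIntegers.mapRingHom (cmConjRingHom F)` of `𝓞 F`,
an involution with `star 𝔭_w = 𝔭_{c•w}`, §1), a finite place `w` and a rational prime `p ∈ 𝔭_w` UNRAMIFIED at `w` (`¬ 𝔭_w² ∣ (p)`), §2 instantiates ★
`exists_blockIdempotentAtLevel`: `εu, c, 𝔟` with `εu² = εu + p^f c`, `(p) = 𝔭_w 𝔟`, `𝔭_w + 𝔟 = 𝓞 F`, `star εu ≡ 1 (𝔭_w^f)`, `star εu ∈ 𝔟`, `εu ≡ 1 (𝔭_{c•w})`,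
`𝔭_{c•w}^f εu ⊆ (p^f)`, `star εu ∈ 𝔟^f` — the `c•w`-block idempotent of the `p^f`-torsion and its conjugate, the `w`-block idempotent.  §3 reads the two `w`-block rows
of ★ `frobCoideal_block_rows` (`𝔠 ē ≡ p^{f−1} ē (mod p^f)` for the Frobenius co-ideal `𝔠 = 𝔞 𝔭_w⁻¹`) off the TWIST-NORM TOKENS `(𝔫) = 𝔞 · c𝔞`, `𝔫 = p^f`,
`𝔞 + 𝔭_{c•w} = 𝓞 F` (★ p847992: `ord_w 𝔞 = ord_w (p^f)`) and unramifiedness (`ord_w (p) = 1`).  Cell `hodgecm-mathlib` (D-0151) organ (W-α) parts (α2)(α3) (LA3-plan (g2)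
deal 2026-09-02; consumer A-p03 (g32) `Lines/F0_P6a_RoofWInstantiation.lean` head `hlaw_w_sch₀Of`, binders `he hp𝔟 hw𝔟 hē1 hē0 hεu1 hεu0 h𝔠₁ h𝔠₂` VERBATIM at `p := I.pChar`,
`f := I.fDeg`, `ē := star εu`); `--supports stmt-HodgeConjecture-24832`, count-neutral.
HC_CM is proved only modulo the 7 printed citations (2 remaining: hLiu418 = stmt-HodgeConjecture-24832, h413 = stmt-HodgeConjecture-24833) until rung 0 closes.

* §1 `mapRingHom_cmConjRingHom_mapRingHom_cmConjRingHom` (`star ∘ star = id` on `𝓞 F`), `mapRingHom_cmConjRingHom_eq_toRingHom` (`star` IS the pointwise action of `c`),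
  `map_mapRingHom_cmConjRingHom_asIdeal` (`star 𝔭_w = 𝔭_{c•w}`), `count_span_natCast_eq_one` (`ord_w (p) = 1` from `p ∈ 𝔭_w`, `¬ 𝔭_w² ∣ (p)`);
* §2 **`exists_cmBlockIdempotentAtLevel`** (α2);
* §3 **`frobCoideal_block_rows_of_twistNorm`** (α3).

## Mathlib / tree search
Mathlib: `NumberField.RingOfIntegers.mapRingHom_apply`, `RingOfIntegers.ext`, `IsCMField.complexConj_apply_apply`, `Ideal.pointwise_smul_def`; tree ★ as imported, ★
`WeilDualityTwoBlockCut.exists_blockIdempotents` (level `p`, both places unramified, pointwise-`•` currency: a different row set, not reused), ★ `BlockIdempotentFamily`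
(through (α1)).  `lean search 'cmBlockIdempotent|frobCoideal_block_rows_of'` = ∅.

## References
* [Neukirch1999] J. Neukirch, *Algebraic Number Theory* (1999), Ch. I §3 (3.6).
* [Shimura1998] G. Shimura, *Abelian Varieties with Complex Multiplication and Modular Functions* (1998), §13.1 Thm. 1 (pp. 97–99).
* [MilneANT2008] J. S. Milne, *Algebraic Number Theory* (v3.00, 2008), Thm. 3.7 (p. 42).
-/

set_option autoImplicit false

namespace Literature.NumberTheory.NumberFields

open NumberField IsDedekindDomain
open Literature.NumberTheory.Automorphic (cmConjRingHom cmConjRingHom_apply)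
open scoped Pointwise

variable {F : Type*} [Field F] [NumberField F] [IsCMField F]

/-! ### §1 Complex conjugation on `𝓞 F` as a ring involution; `ord_w (p) = 1` -/

/-- `star ∘ star = id` on `𝓞 F` for `star = RingOfIntegers.mapRingHom (cmConjRingHom F)` (complex conjugation is an involution). [cite: Shimura1998, §13.1 Thm. 1 (pp. 97–99)] -/
theorem mapRingHom_cmConjRingHom_mapRingHom_cmConjRingHom (x : 𝓞 F) :
    RingOfIntegers.mapRingHom (cmConjRingHom F) (RingOfIntegers.mapRingHom (cmConjRingHom F) x) = x :=
  RingOfIntegers.ext (by rw [RingOfIntegers.mapRingHom_apply, RingOfIntegers.mapRingHom_apply, cmConjRingHom_apply, cmConjRingHom_apply,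
    IsCMField.complexConj_apply_apply])

/-- `RingOfIntegers.mapRingHom (cmConjRingHom F)` IS the ring endomorphism of `𝓞 F` underlying the pointwise action of `c ∈ Aut(F ∕ F⁺)` (both are `x ↦ c x` on
elements). [cite: Shimura1998, §13.1 Thm. 1 (pp. 97–99)] -/
theorem mapRingHom_cmConjRingHom_eq_toRingHom :
    RingOfIntegers.mapRingHom (cmConjRingHom F) = MulSemiringAction.toRingHom (F ≃ₐ[↥(maximalRealSubfield F)] F) (𝓞 F) (IsCMField.complexConj F) :=
  RingHom.ext fun _ => RingOfIntegers.ext rfl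

/-- **`star 𝔭_w = 𝔭_{c•w}`**: the image of `𝔭_w` under complex conjugation on `𝓞 F` is the prime of the conjugate place (★ `GaloisActionPlaces`: `(c • w).asIdeal = c • 𝔭_w`,
definitional). [cite: Shimura1998, §13.1 Thm. 1 (pp. 97–99)] -/
theorem map_mapRingHom_cmConjRingHom_asIdeal (w : HeightOneSpectrum (𝓞 F)) :
    Ideal.map (RingOfIntegers.mapRingHom (cmConjRingHom F)) w.asIdeal = ((IsCMField.complexConj F) • w).asIdeal := by
  rw [mapRingHom_cmConjRingHom_eq_toRingHom]
  rfl

omit [IsCMField F] in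
/-- **`ord_w (p) = 1`** for `p ∈ 𝔭_w` with `¬ 𝔭_w² ∣ (p)` (unramified `w`; `p ≠ 0`). [cite: MilneANT2008, Thm. 3.7 (p. 42)] -/
theorem count_span_natCast_eq_one (w : HeightOneSpectrum (𝓞 F)) {p : ℕ} (hp : p ≠ 0) (hpw : (p : 𝓞 F) ∈ w.asIdeal)
    (hunr : ¬ w.asIdeal ^ 2 ∣ Ideal.span {(p : 𝓞 F)}) :
    (Associates.mk w.asIdeal).count (Associates.mk (Ideal.span {(p : 𝓞 F)})).factors = 1 := by
  have hI : (Ideal.span {(p : 𝓞 F)} : Ideal (𝓞 F)) ≠ ⊥ := span_natCast_ne_bot hp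
  have h1 : 1 ≤ (Associates.mk w.asIdeal).count (Associates.mk (Ideal.span {(p : 𝓞 F)})).factors :=
    (pow_dvd_iff_le_count w hI 1).1 (by rw [pow_one]; exact Ideal.dvd_span_singleton.2 hpw)
  have h2 : ¬ 2 ≤ (Associates.mk w.asIdeal).count (Associates.mk (Ideal.span {(p : 𝓞 F)})).factors :=
    fun h => hunr ((pow_dvd_iff_le_count w hI 2).2 h)
  omega

/-! ### §2 (α2) The `𝔭_{c•w}`-block idempotent at level `p^f` and its conjugate -/

/-- **(W-α2) THE `c•w`-BLOCK IDEMPOTENT `εu` OF `𝓞 F ∕ p^f` AND ITS CONJUGATE `ē = star εu`** — for a finite place `w` of a CM field, `p ∈ 𝔭_w` with `¬ 𝔭_w² ∣ (p)` and `f ≥ 1`: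
`εu c : 𝓞 F`, `𝔟` with `εu·εu = εu + (p^f)•c`, `(p) = 𝔭_w·𝔟`, `𝔭_w ⊔ 𝔟 = ⊤`, `star εu − 1 ∈ 𝔭_w^f`, `star εu ∈ 𝔟`, `εu − 1 ∈ 𝔭_{c•w}`, `𝔭_{c•w}^f·εu ⊆ (p^f)`, `star εu ∈ 𝔟^f`
(★ `exists_blockIdempotentAtLevel` at `star :=` complex conjugation, `P := 𝔭_w`, `P̄ := 𝔭_{c•w}` by §1).  The consumer's binders `he hp𝔟 hw𝔟 hē1 hē0 hεu1 hεu0` in this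
order, then `star εu ∈ 𝔟^f` (the `he` of §3). [cite: Neukirch1999, Ch. I §3 (3.6)] [cite: Shimura1998, §13.1 Thm. 1 (pp. 97–99)] -/
theorem exists_cmBlockIdempotentAtLevel (w : HeightOneSpectrum (𝓞 F)) (p : ℕ) (hpw : (p : 𝓞 F) ∈ w.asIdeal)
    (hunr : ¬ w.asIdeal ^ 2 ∣ Ideal.span {(p : 𝓞 F)}) {f : ℕ} (hf : 1 ≤ f) :
    ∃ (εu c : 𝓞 F) (𝔟 : Ideal (𝓞 F)), εu * εu = εu + (p ^ f) • c ∧ Ideal.span {((p : ℕ) : 𝓞 F)} = w.asIdeal * 𝔟 ∧ w.asIdeal ⊔ 𝔟 = ⊤ ∧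
      RingOfIntegers.mapRingHom (cmConjRingHom F) εu - 1 ∈ w.asIdeal ^ f ∧ RingOfIntegers.mapRingHom (cmConjRingHom F) εu ∈ 𝔟 ∧
      εu - 1 ∈ ((IsCMField.complexConj F) • w).asIdeal ∧
      (∀ b ∈ ((IsCMField.complexConj F) • w).asIdeal ^ f, b * εu ∈ Ideal.span {((p ^ f : ℕ) : 𝓞 F)}) ∧
      RingOfIntegers.mapRingHom (cmConjRingHom F) εu ∈ 𝔟 ^ f :=
  Literature.RingTheory.DedekindDomain.exists_blockIdempotentAtLevel (RingOfIntegers.mapRingHom (cmConjRingHom F))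
    mapRingHom_cmConjRingHom_mapRingHom_cmConjRingHom w.isMaximal (map_mapRingHom_cmConjRingHom_asIdeal w) p hpw hunr hf

/-! ### §3 (α3) The Frobenius co-ideal rows from the twist-norm tokens -/

/-- **(W-α3) THE TWO `w`-BLOCK ROWS OF THE FROBENIUS CO-IDEAL FROM THE TWIST-NORM TOKENS** — `(p) = 𝔭_w·𝔟` with `¬ 𝔭_w² ∣ (p)`, `ē ∈ 𝔟^f`, `𝔠·𝔭_w = 𝔞`, `(𝔫) = 𝔞·c𝔞`,
`𝔫 = p^f`, `𝔞 ⊔ 𝔭_{c•w} = ⊤` ⇒ (h𝔠₁) `∀ a ∈ 𝔠, a·ē = p^{f−1}·b + p^f·c₁` and (h𝔠₂) `∃ a ∈ 𝔠, p^{f−1}·ē = a·b + p^f·c₂` — ★ `frobCoideal_block_rows` with `ord_w (p) = 1` (§1)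
and `ord_w 𝔞 = ord_w (p^f)` (★ p847992 `count_eq_count_span_of_sup_complexConj_smul_eq_top`).  Token shape of the consumer's `h𝔠₁ h𝔠₂` with `ē := star εu`.
[cite: Shimura1998, §13.1 Thm. 1 (pp. 97–99)] [cite: MilneANT2008, Thm. 3.7 (p. 42)] -/
theorem frobCoideal_block_rows_of_twistNorm (w : HeightOneSpectrum (𝓞 F)) {p f 𝔫 : ℕ} (hp : p ≠ 0)
    {𝔞 𝔠 𝔟 : Ideal (𝓞 F)} {e : 𝓞 F}
    (hp𝔟 : Ideal.span {((p : ℕ) : 𝓞 F)} = w.asIdeal * 𝔟) (hunr : ¬ w.asIdeal ^ 2 ∣ Ideal.span {(p : 𝓞 F)}) (he : e ∈ 𝔟 ^ f)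
    (h𝔠 : 𝔠 * w.asIdeal = 𝔞) (hspec : Ideal.span {((𝔫 : ℕ) : 𝓞 F)} = 𝔞 * (IsCMField.complexConj F) • 𝔞) (hnorm : 𝔫 = p ^ f)
    (hpin : 𝔞 ⊔ ((IsCMField.complexConj F) • w).asIdeal = ⊤) :
    (∀ a ∈ 𝔠, ∃ b c₁ : 𝓞 F, a * e = ((p ^ (f - 1) : ℕ) : 𝓞 F) * b + ((p ^ f : ℕ) : 𝓞 F) * c₁) ∧
      ∃ a ∈ 𝔠, ∃ b c₂ : 𝓞 F, ((p ^ (f - 1) : ℕ) : 𝓞 F) * e = a * b + ((p ^ f : ℕ) : 𝓞 F) * c₂ := by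
  subst hnorm
  have hn : p ^ f ≠ 0 := pow_ne_zero _ hp
  have hpw : (p : 𝓞 F) ∈ w.asIdeal := Ideal.dvd_span_singleton.1 ⟨𝔟, hp𝔟⟩
  exact frobCoideal_block_rows w (Nat.cast_ne_zero.2 hp) hp𝔟 (count_span_natCast_eq_one w hp hpw hunr) he
    (ne_bot_of_span_eq_mul_complexConj_smul hn hspec) h𝔠 (count_eq_count_span_of_sup_complexConj_smul_eq_top hn hspec hpin)

end Literature.NumberTheory.NumberFields
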